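import Literature.Probability.Percolation.CorrelationLengthDKTBoundary
import Literature.Probability.Percolation.BondTwoPointLowerBound
import Literature.Probability.Percolation.RegionGluing
import HarnessLib

/-!
# Polynomial un-screening at the wall: `θ_ℍ(0; p) ≥ p (2m+1)^{-2d} (2d)^{-1} · θ_ℍ(m e₀; p)`

Seat `solo-CriticalPhenomena-blind` (generation 3).  `ℍ = {x ∈ ℤ^d | 0 ≤ x₀}` is the standard
half-space (`halfSpace d`), `θ_ℍ(v; p) = P_p(v ↔ ∞ inside ℍ)` the density of the infinite
`ℍ`-cluster seen from a vertex `v` at depth `v₀`.  The wall `∂ℍ` *screens*: `θ_ℍ(0; p) ≤ θ_ℍ(m e₀; p)`.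
We prove that for `p_c(ℤ^d) < p < 1` the screening costs at most a polynomial factor, uniformly
in `p`:

* `exists_lowest_point` — **the lowest-point lemma** (deterministic): if `0 ↔ y` inside the box
  `Λ_m`, and `w` is a vertex of the `Λ_m`-cluster of `0` with the smallest `0`-th coordinate, then
  `w ↔ y` inside the half-space `{z | w₀ ≤ z₀}` — a translate of `ℍ` with `w` ON ITS WALL;
* `exists_deep_point_halfSpace` — hence (union bound over `w`, translation invariance, and the
  DKT face point `P_p(0 ↔ y in Λ_m) ≥ p/(2d(2m+1)^d)` for some `y` with `y₀ = m`, placed on the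
  top face by a signed permutation): **for `p_c < p < 1` there is `v` with `m ≤ v₀ ≤ 2m`,
  `v ∈ Λ_{2m}`, and `P_p(0 ↔ v inside ℍ) ≥ p / (2d (2m+1)^{2d})`**;
* `theta_halfSpace_origin_ge_mul_depth` — Harris–FKG gluing with `{v ↔ ∞ inside ℍ}` and
  monotonicity of `θ_ℍ(·; p)` in the depth: **`θ_ℍ(0; p) ≥ p/(2d(2m+1)^{2d}) · θ_ℍ(m e₀; p)`**
  for all `m ≥ 1`, `p_c(ℤ^d) < p < 1`, `d ≥ 1`; `theta_halfSpace_origin_ge_mul_depth_Z3` is the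
  case `d = 3` in the form used by this sub-problem.

Why it is here (summit map, supercritical side).  At `p_c(ℤ³)` both sides vanish
(Barsky–Grimmett–Newman), so the content is the uniformity in `p ↓ p_c`: any hypothesis giving
`θ_ℍ(k(p); p) ≥ c θ(p)` at a depth `k(p)` polynomial in `1/θ(p)` ("polynomial screening depth")
transfers to the wall with polynomial loss, and `θ_ℍ(0; p) → θ_ℍ(0; p_c) = 0` then forces
`θ(p) → 0`, i.e. `θ(p_c) = 0`.  In exponent language the theorem reads `β₁ ≤ β + 2dν` for the
surface exponent `β₁` (if the exponents exist), and at criticality it bounds the wall-to-bulk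
connection decay from below by `m^{-2d}`.
-/

noncomputable section

namespace Summit.CriticalPhenomena.PercolationContinuityZ3.Theorems

open MeasureTheory Literature.Probability.Percolation Literature.Probability.LatticeModels
open scoped Classical

/-! ### A walk all of whose vertices carry an invariant is a walk of a smaller graph -/

section Walk

variable {V : Type*}

/-- If `P` holds at the start of an `H`-walk and is propagated along `H`-edges, and every `H`-edge
between `P`-vertices is a `K`-edge, then the endpoints are `K`-reachable. -/
theorem reachable_of_walk_of_invariant {H K : SimpleGraph V} (P : V → Prop)
    (hcl : ∀ ⦃u v : V⦄, H.Adj u v → P u → P v)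
    (hK : ∀ ⦃u v : V⦄, H.Adj u v → P u → P v → K.Adj u v) {a b : V} (q : H.Walk a b)
    (ha : P a) : K.Reachable a b := by
  induction q with
  | nil => exact SimpleGraph.Reachable.refl _
  | cons h _ ih => exact (hK h ha (hcl h ha)).reachable.trans (ih (hcl h ha))

/-- Relabelling along a graph isomorphism carries `{x ↔ y via K}` to `{e x ↔ e y via K'}`
(a private copy of the helper of `SoloBlindPeriodicFinRate`, to keep the imports light). -/
private theorem relabel_preimage_openConnVia_aux {V' : Type*} (e : V ≃ V') {K : SimpleGraph V}
    {K' : SimpleGraph V'} (hK : ∀ u v, K'.Adj (e u) (e v) ↔ K.Adj u v) (x y : V) :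
    BondConfig.relabel (sym2Equiv e) ⁻¹' openConnVia K' (e x) (e y) = openConnVia K x y := by
  ext ω
  simp only [Set.mem_preimage, openConnVia, Set.mem_setOf_eq]
  rw [openClusterIn_relabel e hK ω x, e.injective.mem_set_image]

end Walk

/-! ### The lowest-point lemma -/

section Lattice

variable {d : ℕ} [NeZero d]

/-- **Lowest-point lemma.** If `0 ↔ y` inside `Λ_m`, then for a lowest vertex `w` of the
`Λ_m`-cluster of `0` (one minimising the `0`-th coordinate; `w ∈ Λ_m`, `w₀ ≤ 0`) we have
`w ↔ y` inside the half-space `{z | w₀ ≤ z₀}`: the whole box-cluster lies on or above the level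
of `w`. -/
theorem exists_lowest_point {m : ℕ} {y : Site d} {ω : BondConfig (Site d)}
    (h : ω ∈ AKN.bconn (box d m) 0 y) :
    ∃ w ∈ box d m, w 0 ≤ 0 ∧ ω ∈ openConnVia (withinGraph (zdGraph d) {z : Site d | w 0 ≤ z 0}) w y := by
  set H := openGraph ω ⊓ withinGraph (zdGraph d) (↑(box d m) : Set (Site d)) with hH
  have hy : H.Reachable 0 y := mem_openClusterIn_iff.1 h
  have hmembox : ∀ u, H.Reachable 0 u → u ∈ box d m := fun u hu =>
    Finset.mem_coe.1 (openClusterIn_withinGraph_subset (G := zdGraph d)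
      (Finset.mem_coe.2 (zero_mem_box d m)) ω (mem_openClusterIn_iff.2 hu))
  set C := (box d m).filter (fun z => H.Reachable 0 z) with hC
  have hmemC : ∀ u, H.Reachable 0 u → u ∈ C := fun u hu =>
    Finset.mem_filter.2 ⟨hmembox u hu, hu⟩
  have h0C : (0 : Site d) ∈ C := hmemC 0 (SimpleGraph.Reachable.refl _)
  obtain ⟨w, hwC, hmin⟩ := Finset.exists_min_image C (fun z => z 0) ⟨0, h0C⟩
  have hwbox : w ∈ box d m := (Finset.mem_filter.1 hwC).1
  have hw : H.Reachable 0 w := (Finset.mem_filter.1 hwC).2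
  refine ⟨w, hwbox, by simpa using hmin 0 h0C, ?_⟩
  obtain ⟨q⟩ := hw.symm.trans hy
  change y ∈ openClusterIn (withinGraph (zdGraph d) {z : Site d | w 0 ≤ z 0}) ω w
  rw [mem_openClusterIn_iff]
  refine reachable_of_walk_of_invariant (fun u => H.Reachable 0 u) (fun u v huv hu => hu.trans huv.reachable)
    (fun u v huv hu hv => ?_) q hw
  have huv' := huv
  rw [hH, SimpleGraph.inf_adj, withinGraph_adj] at huv'
  rw [SimpleGraph.inf_adj, withinGraph_adj]
  exact ⟨huv'.1, huv'.2.1, hmin u (hmemC u hu), hmin v (hmemC v hv)⟩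

/-- Translation by `-w`: `P_p(w ↔ y inside {z | w₀ ≤ z₀}) = P_p(0 ↔ y - w inside ℍ)`. -/
theorem real_openConnVia_aboveLevel_eq (p : unitInterval) (w y : Site d) :
    (bondPercolation (zdGraph d) p).real (openConnVia (withinGraph (zdGraph d) {z : Site d | w 0 ≤ z 0}) w y) =
      (bondPercolation (zdGraph d) p).real
        (openConnVia (withinGraph (zdGraph d) (halfSpace d)) 0 (y - w)) := by
  have hK : ∀ u v : Site d, (withinGraph (zdGraph d) (halfSpace d)).Adj (Site.shift (-w) u)
      (Site.shift (-w) v) ↔ (withinGraph (zdGraph d) {z : Site d | w 0 ≤ z 0}).Adj u v := by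
    intro u v
    rw [withinGraph_adj, withinGraph_adj, zdGraph_adj_shift_iff]
    simp only [halfSpace, Set.mem_setOf_eq, Site.shift_apply, Pi.add_apply, Pi.neg_apply]
    constructor
    · rintro ⟨h1, h2, h3⟩; exact ⟨h1, by omega, by omega⟩
    · rintro ⟨h1, h2, h3⟩; exact ⟨h1, by omega, by omega⟩
  have h := relabel_preimage_openConnVia_aux (Site.shift (-w)) hK w y
  rw [← h, bondPercolation_real_preimage_shift]
  simp only [Site.shift_apply, add_neg_cancel, ← sub_eq_add_neg]

/-- **Depth monotonicity with lateral invariance.** For `u ∈ ℤ^d` with `u₀ ≥ m`: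
`P_p(m e₀ ↔ ∞ inside ℍ) ≤ P_p(u ↔ ∞ inside ℍ)` (translate by `u - m e₀`, which maps `ℍ` onto a
half-space containing `ℍ`). -/
theorem real_percolatesVia_halfSpace_depth_mono (p : unitInterval) {m : ℕ} {u : Site d}
    (hu : (m : ℤ) ≤ u 0) :
    (bondPercolation (zdGraph d) p).real
        (percolatesVia (withinGraph (zdGraph d) (halfSpace d)) (Pi.single 0 (m : ℤ))) ≤
      (bondPercolation (zdGraph d) p).real (percolatesVia (withinGraph (zdGraph d) (halfSpace d)) u) := by
  set t : Site d := u - Pi.single 0 (m : ℤ) with ht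
  have ht0 : 0 ≤ t 0 := by simp [ht]; omega
  set R : Set (Site d) := {z | 0 ≤ z 0 + t 0} with hR
  have hK : ∀ a b : Site d, (withinGraph (zdGraph d) (halfSpace d)).Adj (Site.shift t a) (Site.shift t b) ↔
      (withinGraph (zdGraph d) R).Adj a b := by
    intro a b
    rw [withinGraph_adj, withinGraph_adj, zdGraph_adj_shift_iff]
    simp only [halfSpace, hR, Set.mem_setOf_eq, Site.shift_apply, Pi.add_apply]
  have h1 := relabel_preimage_percolatesVia (Site.shift t) hK (Pi.single 0 (m : ℤ))
  have hut : Site.shift t (Pi.single 0 (m : ℤ)) = u := by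
    rw [Site.shift_apply, ht]; abel
  rw [hut] at h1
  rw [← bondPercolation_real_preimage_shift t p (percolatesVia (withinGraph (zdGraph d) (halfSpace d)) u), h1]
  refine measureReal_mono (percolatesVia_mono_graph (withinGraph_mono _ fun z hz => ?_) _)
    (measure_ne_top _ _)
  simp only [halfSpace, Set.mem_setOf_eq] at hz
  show 0 ≤ z 0 + t 0
  exact add_nonneg hz ht0

omit [NeZero d] in
/-- **Harris–FKG gluing.** `P_p(x ↔ v via K) · P_p(v ↔ ∞ via K) ≤ P_p(x ↔ ∞ via K)`. -/
theorem real_openConnVia_mul_percolatesVia_le (p : unitInterval) (K : SimpleGraph (Site d))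
    (x v : Site d) :
    (bondPercolation (zdGraph d) p).real (openConnVia K x v) *
        (bondPercolation (zdGraph d) p).real (percolatesVia K v) ≤
      (bondPercolation (zdGraph d) p).real (percolatesVia K x) := by
  refine (harris_fkg_holds (zdGraph d) p (isUpperSet_openConnVia _ _ _) (isUpperSet_percolatesVia _ _)
    (measurableSet_openConnVia _ _ _) (measurableSet_percolatesVia _ _)).trans ?_
  refine measureReal_mono (fun ω hω => ?_) (measure_ne_top _ _)
  exact (mem_percolatesVia_iff_of_mem hω.1).1 hω.2

/-- **A good point on the top face** (DKT face point, moved to the face `{y₀ = m}` by a signed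
permutation of the coordinates): for `p_c(ℤ^d) < p < 1` and `m ≥ 1` there is `y ∈ Λ_m` with
`y₀ = m` and `P_p(0 ↔ y inside Λ_m) ≥ p / (2d (2m+1)^d)`. -/
theorem exists_top_face_point (p : unitInterval) (hpc : criticalProb (zdGraph d) 0 < p)
    (hp1 : (p : ℝ) < 1) {m : ℕ} (hm : 1 ≤ m) :
    ∃ y ∈ box d m, y 0 = m ∧
      (p : ℝ) / (2 * d * (2 * m + 1) ^ d) ≤ (bondPercolation (zdGraph d) p).real (AKN.bconn (box d m) 0 y) := by
  have hd : 1 ≤ d := Nat.one_le_iff_ne_zero.2 (NeZero.ne d)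
  obtain ⟨y, hy, ⟨i, hi⟩, hbound⟩ := DKT20.exists_face_point hd p hpc hp1 hm
  have hconv : (bondPercolation (zdGraph d) p).real (openConnIn (↑(box d m)) 0 y) =
      (bondPercolation (zdGraph d) p).real (AKN.bconn (box d m) 0 y) :=
    measureReal_congr (openConnIn_ae_eq_openConnVia (zdGraph d) p (Finset.mem_coe.2 (zero_mem_box d m)) y)
  set s : ℤˣ := if 0 ≤ y i then 1 else -1 with hs
  set ε : Fin d → ℤˣ := fun j => if j = 0 then s else 1 with hε
  set π : Equiv.Perm (Fin d) := Equiv.swap 0 i with hπ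
  refine ⟨Site.signedPerm π ε y, (signedPerm_mem_box_iff π ε).2 hy, ?_, ?_⟩
  · have h1 : Site.signedPerm π ε y 0 = (s : ℤ) * y i := by
      rw [Site.signedPerm_apply, hπ, Equiv.symm_swap, Equiv.swap_apply_left, hε]
      simp
    rw [h1, hs]
    by_cases hyi : 0 ≤ y i
    · rw [if_pos hyi, Units.val_one, one_mul, ← hi, abs_of_nonneg hyi]
    · rw [if_neg hyi, Units.val_neg, Units.val_one, neg_one_mul, ← hi, abs_of_neg (not_le.1 hyi)]
  · rw [AKN.real_bconn_signedPerm, ← hconv]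
    exact hbound

/-- **Wall-to-depth connections inside `ℍ` are at least polynomially likely.** For
`p_c(ℤ^d) < p < 1` and `m ≥ 1` there is `v ∈ Λ_{2m}` with `v₀ ≥ m` such that
`P_p(0 ↔ v inside ℍ) ≥ p / (2d (2m+1)^{2d})`. -/
theorem exists_deep_point_halfSpace (p : unitInterval) (hpc : criticalProb (zdGraph d) 0 < p)
    (hp1 : (p : ℝ) < 1) {m : ℕ} (hm : 1 ≤ m) :
    ∃ v ∈ box d (2 * m), (m : ℤ) ≤ v 0 ∧
      (p : ℝ) / (2 * d * (2 * m + 1) ^ d) / (2 * m + 1) ^ d ≤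
        (bondPercolation (zdGraph d) p).real (openConnVia (withinGraph (zdGraph d) (halfSpace d)) 0 v) := by
  set μ := bondPercolation (zdGraph d) p with hμ
  obtain ⟨y, hy, hy0, hbound⟩ := exists_top_face_point p hpc hp1 hm
  set t : ℝ := (p : ℝ) / (2 * d * (2 * m + 1) ^ d) with ht
  -- the lowest points
  set B := (box d m).filter (fun w : Site d => w 0 ≤ 0) with hB
  have hcover : AKN.bconn (box d m) 0 y ⊆
      ⋃ w ∈ B, openConnVia (withinGraph (zdGraph d) {z : Site d | w 0 ≤ z 0}) w y := by
    intro ω hω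
    obtain ⟨w, hwbox, hw0, hw⟩ := exists_lowest_point hω
    exact Set.mem_biUnion (Finset.mem_filter.2 ⟨hwbox, hw0⟩) hw
  have hsum : t ≤ ∑ w ∈ B, μ.real (openConnVia (withinGraph (zdGraph d) (halfSpace d)) 0 (y - w)) := by
    calc t ≤ μ.real (AKN.bconn (box d m) 0 y) := hbound
      _ ≤ μ.real (⋃ w ∈ B, openConnVia (withinGraph (zdGraph d) {z : Site d | w 0 ≤ z 0}) w y) :=
          measureReal_mono hcover (measure_ne_top _ _)
      _ ≤ ∑ w ∈ B, μ.real (openConnVia (withinGraph (zdGraph d) {z : Site d | w 0 ≤ z 0}) w y) :=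
          measureReal_biUnion_finset_le _ _
      _ = ∑ w ∈ B, μ.real (openConnVia (withinGraph (zdGraph d) (halfSpace d)) 0 (y - w)) :=
          Finset.sum_congr rfl fun w _ => real_openConnVia_aboveLevel_eq p w y
  have hBne : B.Nonempty := ⟨0, Finset.mem_filter.2 ⟨zero_mem_box d m, le_rfl⟩⟩
  have hcardB : (B.card : ℝ) ≤ (2 * m + 1) ^ d := by
    have h1 : B.card ≤ (box d m).card := Finset.card_filter_le _ _
    have h2 : (box d m).card = (2 * m + 1) ^ d := by
      have : box d m = GM.ball (0 : Site d) m := by ext z; simp [mem_box]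
      rw [this, GM.card_ball]
    rw [h2] at h1
    exact_mod_cast h1
  have hcardpos : (0 : ℝ) < B.card := by exact_mod_cast hBne.card_pos
  have ht0 : 0 ≤ t := by rw [ht]; exact div_nonneg p.2.1 (by positivity)
  -- pigeonhole
  obtain ⟨w, hwB, hw⟩ : ∃ w ∈ B, t / B.card ≤
      μ.real (openConnVia (withinGraph (zdGraph d) (halfSpace d)) 0 (y - w)) := by
    by_contra hno
    push Not at hno
    have : ∑ w ∈ B, μ.real (openConnVia (withinGraph (zdGraph d) (halfSpace d)) 0 (y - w)) <
        ∑ w ∈ B, t / B.card := Finset.sum_lt_sum_of_nonempty hBne fun w hw => hno w hw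
    rw [Finset.sum_const, nsmul_eq_mul, mul_div_cancel₀ _ hcardpos.ne'] at this
    linarith
  have hwbox : w ∈ box d m := (Finset.mem_filter.1 hwB).1
  have hw0 : w 0 ≤ 0 := (Finset.mem_filter.1 hwB).2
  refine ⟨y - w, ?_, ?_, ?_⟩
  · rw [mem_box]
    intro j
    have hyj := (mem_box.1 hy) j
    have hwj := (mem_box.1 hwbox) j
    simp only [Pi.sub_apply]
    push_cast
    constructor <;> omega
  · simp only [Pi.sub_apply]; omega
  · calc t / (2 * m + 1) ^ d ≤ t / B.card := div_le_div_of_nonneg_left ht0 hcardpos hcardB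
      _ ≤ _ := hw

/-- **Polynomial un-screening at the wall.** For `d ≥ 1`, `p_c(ℤ^d) < p < 1` and `m ≥ 1`:
`p / (2d (2m+1)^{2d}) · θ_ℍ(m e₀; p) ≤ θ_ℍ(0; p)`, where `θ_ℍ(v; p)` is the percolation
probability of bond percolation on the induced half-space graph `ℍ = {0 ≤ x₀}` seen from `v`. -/
theorem theta_halfSpace_origin_ge_mul_depth (p : unitInterval) (hpc : criticalProb (zdGraph d) 0 < p)
    (hp1 : (p : ℝ) < 1) {m : ℕ} (hm : 1 ≤ m) :
    (p : ℝ) / (2 * d * (2 * m + 1) ^ d) / (2 * m + 1) ^ d *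
        theta (halfSpaceGraph d) ⟨Pi.single 0 (m : ℤ), by simp [halfSpace]⟩ p ≤
      theta (halfSpaceGraph d) (halfSpaceOrigin d) p := by
  set μ := bondPercolation (zdGraph d) p with hμ
  obtain ⟨v, -, hv0, hv⟩ := exists_deep_point_halfSpace p hpc hp1 hm
  have hθm : theta (halfSpaceGraph d) ⟨Pi.single 0 (m : ℤ), by simp [halfSpace]⟩ p =
      μ.real (percolatesVia (withinGraph (zdGraph d) (halfSpace d)) (Pi.single 0 (m : ℤ))) :=
    theta_induce_eq_real_percolatesVia (zdGraph d) (halfSpace d) _ _ p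
  have hθ0 : theta (halfSpaceGraph d) (halfSpaceOrigin d) p =
      μ.real (percolatesVia (withinGraph (zdGraph d) (halfSpace d)) 0) :=
    theta_induce_eq_real_percolatesVia (zdGraph d) (halfSpace d) _ _ p
  rw [hθm, hθ0]
  have hnonneg : 0 ≤ (p : ℝ) / (2 * d * (2 * m + 1) ^ d) / (2 * m + 1) ^ d :=
    div_nonneg (div_nonneg p.2.1 (by positivity)) (by positivity)
  calc (p : ℝ) / (2 * d * (2 * m + 1) ^ d) / (2 * m + 1) ^ d *
        μ.real (percolatesVia (withinGraph (zdGraph d) (halfSpace d)) (Pi.single 0 (m : ℤ)))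
      ≤ μ.real (openConnVia (withinGraph (zdGraph d) (halfSpace d)) 0 v) *
          μ.real (percolatesVia (withinGraph (zdGraph d) (halfSpace d)) v) :=
        mul_le_mul hv (real_percolatesVia_halfSpace_depth_mono p hv0) measureReal_nonneg measureReal_nonneg
    _ ≤ μ.real (percolatesVia (withinGraph (zdGraph d) (halfSpace d)) 0) :=
        real_openConnVia_mul_percolatesVia_le p _ 0 v

end Lattice

/-! ### The case `d = 3` -/

/-- **Un-screening on `ℤ³`.** For `p_c(ℤ³) < p < 1` and `m ≥ 1`:
`p / (6 (2m+1)^6) · θ_ℍ((m,0,0); p) ≤ θ_ℍ(0; p)` for the half-space `ℍ = {x ∈ ℤ³ | 0 ≤ x₀}` of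
this sub-problem (`(zdGraph 3).induce {x | 0 ≤ x 0}`). -/
theorem theta_halfSpace_origin_ge_mul_depth_Z3 (p : unitInterval) (hpc : criticalProbI 3 < p)
    (hp1 : (p : ℝ) < 1) {m : ℕ} (hm : 1 ≤ m) :
    (p : ℝ) / (6 * (2 * m + 1) ^ 6) *
        theta ((zdGraph 3).induce {x : Site 3 | 0 ≤ x 0}) ⟨Pi.single 0 (m : ℤ), by simp⟩ p ≤
      theta ((zdGraph 3).induce {x : Site 3 | 0 ≤ x 0}) ⟨0, Set.mem_setOf.mpr le_rfl⟩ p := by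
  have hpc' : criticalProb (zdGraph 3) 0 < p := by
    have : ((criticalProbI 3 : unitInterval) : ℝ) < p := hpc
    simpa using this
  have h := theta_halfSpace_origin_ge_mul_depth (d := 3) p hpc' hp1 hm
  have hconst : (p : ℝ) / (2 * (3 : ℕ) * (2 * m + 1) ^ 3) / (2 * m + 1) ^ 3 = (p : ℝ) / (6 * (2 * m + 1) ^ 6) := by
    push_cast
    field_simp
    ring
  rw [hconst] at h
  exact h

end Summit.CriticalPhenomena.PercolationContinuityZ3.Theorems
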